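import Literature.AlgebraicGeometry.HodgeTheory.CyclicCoverScalingMonodromy
import Literature.AlgebraicGeometry.HodgeTheory.DiagonalSymmetryStability
import Literature.AlgebraicGeometry.HodgeTheory.IsoTransport
import Literature.AlgebraicGeometry.HodgeTheory.CyclicCoverMeridianMonodromy
import HarnessLib

/-!
# The covering transformation of a cyclic cover is a monodromy transformation; discharge of
# `carlsonToledo1999_monodromyInvariants_eq_deckInvariants`

Family `hodge`, layer `Literature/AlgebraicGeometry/HodgeTheory`. Last file of the series
`CyclicCoverScalingFamily` / `CyclicCoverScalingCoordinates` / `CyclicCoverScalingMonodromy` (seat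
`hodge-nonav-prover-Ax` g7, crux K1 `VeryGeneralDeckCommutatorsInHg` of route `CyclicUnitaryPowers`,
stmt-HodgeConjecture-19544).

* §4 `isRatTransport_familySpz_iff` — rational transports of ANY specialised family `familySpz φ` versus those of the
  universal family of hypersurfaces along the image path (the local system `R^k u_* ℚ` of the base change is the
  inverse image; `FiberClass.baseChange_transportFun_of_isCohomologicallyLocallyTrivialOn`), the `familyM` lemma of
  `MonomialSupportedHypersurfaceMonodromy` for specialised families.
* §5 `deckInvPull` (`(σ_F⁻¹)^*` as a linear automorphism of `H^k(X_F; ℚ)`), `isRatTransport_scalingLoop` (the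
  rational transport along the scaling loop of the scaling family is `e^* (σ_F⁻¹)^* (e^*)⁻¹`), the Carlson–Toledo loop
  `ctLoop : u ↦ [x₃^p − e^{2πiu} f]` in the base `S(ℂ)` of `cyclicCoverFamily p` and its common image `uLoop` with the
  scaling loop in `U(ℂ)`.
* §6 **`isRatTransport_ctLoop`**, **`deck_mem_ratMonodromyGroup`** — for the identification `e : 𝒴_{[F]} ≅ X_F`
  compatible with the embeddings (`IsCompatibleFibreIso`, unique) and `τ` matched with `σ_F^*`: the rational
  transport along `ctLoop` is `τ⁻¹`, so **`τ⁻¹, τ ∈ Γ = ratMonodromyGroup`** (base change scaling family → universal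
  family → Carlson–Toledo family; uniqueness of compatible identifications); and the DISCHARGE
  **`carlsonToledo1999_monodromyInvariants_eq_deckInvariants_holds`**: a class fixed by the monodromy group is
  fixed by `τ` — unconditionally, with no appeal to Deligne's theorem of the fixed part (the route printed in
  Carlson–Toledo §3 via Hodge II 4.1.1), because the covering transformation is itself a monodromy of the family
  over the affine space of branch forms (§2: the base `Ũ ⊆ ℂ^{N+1}` is stable under scaling, and over the scaling
  circle the family `x₃^p = e^{2πiu} f` is trivialised by `x₃ ↦ e^{2πiu/p} x₃`, with holonomy `x₃ ↦ ζ_p x₃`).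

Theorems and concrete definitions only; no named fact; net debt −1.

## References

* [CarlsonToledo1999] J. A. Carlson, D. Toledo, Discriminant complements and kernels of monodromy
  representations, Duke Math. J. 97 (1999), §2 (held text p0004–p0005), §3 (p0006), §7 last ¶ (p0016).
* [VoisinHodgeII2003] C. Voisin, Hodge Theory and Complex Algebraic Geometry II, CUP 2003, §3.1.2, §6.2.1.
* [Katz2009] N. M. Katz, Another look at the Dwork family, Progr. Math. 269 (2009), §3.
-/

noncomputable section


namespace Literature.AlgebraicGeometry.HodgeTheory

open CategoryTheory MvPolynomial
open _root_.Topology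
open Literature.AlgebraicGeometry.Motives Literature.AlgebraicGeometry.Motives.UniversalHypersurface
open Literature.AlgebraicGeometry.HodgeTheory.UniversalHypersurface
open Literature.AlgebraicTopology.SingularHomology
open Literature.NumberTheory.Transcendental
open scoped LinearAlgebra.Projectivization

namespace CyclicCoverScaling

/-! ### §4 Rational transports under the base change `𝒴_φ = 𝒴_U ×_U S_φ → 𝒴_U` -/

section BaseChange

variable {n d : ℕ} {ι : Type} (φ : CoeffRing ℂ n d →ₐ[ℂ] MvPolynomial ι ℂ) (k : ℕ)

/-- The fibre identification `𝒴_{φ,t} ≅ 𝒴_{g t}` of the base change. [cite: VoisinHodgeII2003, §6.2.1] -/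
abbrev fibIso (t : ComplexPoints (baseSpz ℂ n d φ)) :
    fiberOver (familySpz ℂ n d φ) t ≅ fiberOver (family ℂ n d) (AlgPoints.map (toBaseSpz ℂ n d φ) t) :=
  fiberOverFamilyPullbackIso (family ℂ n d) (toBaseSpz ℂ n d φ) t

/-- **Transport commutes with the base change** `𝒴_φ → 𝒴_U` (complex coefficients): the local system of the
specialised family is the inverse image of `Rᵏ π_* ℂ` (`FiberClass.baseChange_transportFun_of_isCohomologicallyLocallyTrivialOn`).
[cite: VoisinHodgeII2003, §3.1.2] -/
theorem map_inv_transportFun_familySpz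
    (hU : IsCohomologicallyLocallyTrivialOn (family ℂ n d) Set.univ)
    (hU' : IsCohomologicallyLocallyTrivialOn (familySpz ℂ n d φ) Set.univ)
    {s' t' : (Set.univ : Set (ComplexPoints (baseSpz ℂ n d φ)))} (γ' : Path s' t')
    (γ : Path (⟨AlgPoints.map (toBaseSpz ℂ n d φ) s'.1, Set.mem_univ _⟩ :
        (Set.univ : Set (ComplexPoints (base ℂ n d))))
      ⟨AlgPoints.map (toBaseSpz ℂ n d φ) t'.1, Set.mem_univ _⟩)
    (hγ : ∀ u, AlgPoints.map (toBaseSpz ℂ n d φ) (γ' u).1 = (γ u).1)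
    (α' : complexBetti (fiberOver (familySpz ℂ n d φ) s'.1) k) :
    complexBetti.map (fibIso φ t'.1).inv k (transportFun (familySpz ℂ n d φ) k hU' ⟦γ'⟧ α') =
      transportFun (family ℂ n d) k hU ⟦γ⟧ (complexBetti.map (fibIso φ s'.1).inv k α') := by
  have h := FiberClass.baseChange_transportFun_of_isCohomologicallyLocallyTrivialOn (family ℂ n d)
    (toBaseSpz ℂ n d φ) hU hU' k γ γ' hγ α' (α := complexBetti.map (fibIso φ s'.1).inv k α') rfl
  exact ((FiberClass.mk_eq_mk_iff _ _).1 h).symm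

/-- **Rational transports under the base change**: `T'` is the rational transport along `γ'` in the specialised
family iff its conjugate by the fibre identifications is the rational transport along the image path in the
universal family. [cite: VoisinHodgeII2003, §3.1.2] -/
theorem isRatTransport_familySpz_iff
    (hU : IsCohomologicallyLocallyTrivialOn (family ℂ n d) Set.univ)
    (hU' : IsCohomologicallyLocallyTrivialOn (familySpz ℂ n d φ) Set.univ)
    {s' t' : (Set.univ : Set (ComplexPoints (baseSpz ℂ n d φ)))} (γ' : Path s' t')
    (γ : Path (⟨AlgPoints.map (toBaseSpz ℂ n d φ) s'.1, Set.mem_univ _⟩ :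
        (Set.univ : Set (ComplexPoints (base ℂ n d))))
      ⟨AlgPoints.map (toBaseSpz ℂ n d φ) t'.1, Set.mem_univ _⟩)
    (hγ : ∀ u, AlgPoints.map (toBaseSpz ℂ n d φ) (γ' u).1 = (γ u).1)
    (T' : bettiCohomology (fiberOver (familySpz ℂ n d φ) s'.1) k ≃ₗ[ℚ]
      bettiCohomology (fiberOver (familySpz ℂ n d φ) t'.1) k) :
    IsRatTransport (familySpz ℂ n d φ) k hU' ⟦γ'⟧ T' ↔
      IsRatTransport (family ℂ n d) k hU ⟦γ⟧
        ((BettiUniverse.pullEquiv (fibIso φ s'.1) k).symm ≪≫ₗ T' ≪≫ₗ BettiUniverse.pullEquiv (fibIso φ t'.1) k) := by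
  have hQ : ∀ v' : bettiCohomology (fiberOver (familySpz ℂ n d φ) s'.1) k,
      BettiUniverse.pull (fibIso φ s'.1).hom k (BettiUniverse.pull (fibIso φ s'.1).inv k v') = v' := fun v' => by
    rw [← LinearMap.comp_apply, ← BettiUniverse.pull_comp, Iso.hom_inv_id, BettiUniverse.pull_id]; rfl
  have hQ' : ∀ v : bettiCohomology (fiberOver (family ℂ n d) (AlgPoints.map (toBaseSpz ℂ n d φ) s'.1)) k,
      BettiUniverse.pull (fibIso φ s'.1).inv k (BettiUniverse.pull (fibIso φ s'.1).hom k v) = v := fun v => by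
    rw [← LinearMap.comp_apply, ← BettiUniverse.pull_comp, Iso.inv_hom_id, BettiUniverse.pull_id]; rfl
  have hnat : ∀ {X Y : SchemeOver ℂ} (f : X ⟶ Y) (v : bettiCohomology Y k),
      ofRatClass _ k (BettiUniverse.pull f k v) = complexBetti.map f k (ofRatClass _ k v) := fun f v =>
    ofRatClass_map k (AlgPoints.mapContinuous (L := ℂ) f) v
  have key : ∀ v' : bettiCohomology (fiberOver (familySpz ℂ n d φ) s'.1) k,
      ofRatClass _ k (((BettiUniverse.pullEquiv (fibIso φ s'.1) k).symm ≪≫ₗ T' ≪≫ₗ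
          BettiUniverse.pullEquiv (fibIso φ t'.1) k) (BettiUniverse.pull (fibIso φ s'.1).inv k v')) =
        complexBetti.map (fibIso φ t'.1).inv k (ofRatClass _ k (T' v')) := fun v' => by
    rw [LinearEquiv.trans_apply, LinearEquiv.trans_apply, BettiUniverse.pullEquiv_symm_apply,
      BettiUniverse.pullEquiv_apply, hQ, hnat]
  constructor
  · intro hT' v
    conv_lhs => rw [← hQ' v]
    rw [key, hT', map_inv_transportFun_familySpz φ k hU hU' γ' γ hγ, hnat,
      (fibIso φ s'.1).complexBetti_map_inv_map_hom]
  · intro hT v'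
    have hinj : Function.Injective (complexBetti.map (fibIso φ t'.1).inv k) :=
      complexBetti_map_fiberOverFamilyPullbackIso_inv_injective (family ℂ n d) (toBaseSpz ℂ n d φ) t'.1 k
    apply hinj
    rw [map_inv_transportFun_familySpz φ k hU hU' γ' γ hγ, ← key, hT, hnat]

end BaseChange

/-! ### §5 The deck transformation is the monodromy of the scaling loop -/

section Deck

variable {p : ℕ} [NeZero p] {f : MvPolynomial (Fin 3) ℂ}

/-- `g_a ≫ g_{a⁻¹} = 𝟙` over `ℂ`. [cite: Katz2009, §3] -/
theorem diagonalAut_comp_inv_over {F : MvPolynomial (Fin 4) ℂ} {a : Fin 4 → ℂˣ} (ha : a ∈ diagonalStabilizer F) :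
    diagonalAut F ha ≫ diagonalAut F (inv_mem ha) = 𝟙 _ :=
  Over.OverMorphism.ext (diagonalAut_left_comp_inv F ha)

/-- `g_{a⁻¹} ≫ g_a = 𝟙` over `ℂ`. [cite: Katz2009, §3] -/
theorem diagonalAut_inv_comp_over {F : MvPolynomial (Fin 4) ℂ} {a : Fin 4 → ℂˣ} (ha : a ∈ diagonalStabilizer F) :
    diagonalAut F (inv_mem ha) ≫ diagonalAut F ha = 𝟙 _ :=
  Over.OverMorphism.ext (diagonalAut_left_inv_comp F ha)

variable (p f) in
/-- **`(σ_F⁻¹)^*` as a linear automorphism of `Hᵏ(X_F(ℂ); ℚ)`** (inverse `σ_F^*`), `σ_F = diagonalAut (deckUnit p)`.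
[cite: CarlsonToledo1999, §2 (held text p0005)] -/
def deckInvPull (k : ℕ) : bettiCohomology (SmoothHypersurface.hypersurface (cyclicCoverForm p f)) k ≃ₗ[ℚ]
    bettiCohomology (SmoothHypersurface.hypersurface (cyclicCoverForm p f)) k :=
  LinearEquiv.ofLinear
    (BettiUniverse.pull (diagonalAut (cyclicCoverForm p f)
      (inv_mem (deckUnit_mem_diagonalStabilizer (NeZero.ne p) f))) k)
    (BettiUniverse.pull (diagonalAut (cyclicCoverForm p f) (deckUnit_mem_diagonalStabilizer (NeZero.ne p) f)) k)
    (by rw [← BettiUniverse.pull_comp, diagonalAut_inv_comp_over, BettiUniverse.pull_id])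
    (by rw [← BettiUniverse.pull_comp, diagonalAut_comp_inv_over, BettiUniverse.pull_id])

/-- `deckInvPull` acts by `(σ_F⁻¹)^*`. [cite: CarlsonToledo1999, §2 (held text p0005)] -/
theorem deckInvPull_apply (k : ℕ) (v : bettiCohomology (SmoothHypersurface.hypersurface (cyclicCoverForm p f)) k) :
    deckInvPull p f k v = BettiUniverse.pull (diagonalAut (cyclicCoverForm p f)
      (inv_mem (deckUnit_mem_diagonalStabilizer (NeZero.ne p) f))) k v := rfl

/-- **The characterising property of the scaling monodromy at a point of the universal family**: conjugate of
`(σ_F⁻¹)^*` by an embedding-compatible identification of the fibre with `X_F`. [cite: CarlsonToledo1999, §2 (held text p0005)] -/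
def IsDeckInvTransportAt (s : ComplexPoints (base ℂ 2 p))
    (T : bettiCohomology (fiberOver (family ℂ 2 p) s) 2 ≃ₗ[ℚ] bettiCohomology (fiberOver (family ℂ 2 p) s) 2) : Prop :=
  ∃ ê : fiberOver (family ℂ 2 p) s ≅ SmoothHypersurface.hypersurface (cyclicCoverForm p f),
    ê.hom ≫ SmoothHypersurface.hypersurfaceι (cyclicCoverForm p f) =
      fiberι (family ℂ 2 p) s ≫ UniversalHypersurface.toProjectiveSpace ℂ 2 p ∧
    ∀ x, T x = BettiUniverse.pull ê.hom 2 (deckInvPull p f 2 (BettiUniverse.pull ê.inv 2 x))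

omit [NeZero p] in
/-- Transfer of a rational transport with the property along an equality of base points. [cite: VoisinHodgeII2003, §3.1.2] -/
theorem exists_isRatTransport_of_eq [NeZero p] (hU : IsCohomologicallyLocallyTrivialOn (family ℂ 2 p) Set.univ)
    {s₁ s₂ : (Set.univ : Set (ComplexPoints (base ℂ 2 p)))} (h : s₁ = s₂)
    (γ₁ : Path s₁ s₁) (γ₂ : Path s₂ s₂) (hγ : ∀ u, (γ₁ u).1 = (γ₂ u).1)
    {T₁ : bettiCohomology (fiberOver (family ℂ 2 p) s₁.1) 2 ≃ₗ[ℚ] bettiCohomology (fiberOver (family ℂ 2 p) s₁.1) 2}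
    (hT₁ : IsRatTransport (family ℂ 2 p) 2 hU ⟦γ₁⟧ T₁) (hP : IsDeckInvTransportAt (f := f) s₁.1 T₁) :
    ∃ T₂ : bettiCohomology (fiberOver (family ℂ 2 p) s₂.1) 2 ≃ₗ[ℚ] bettiCohomology (fiberOver (family ℂ 2 p) s₂.1) 2,
      IsRatTransport (family ℂ 2 p) 2 hU ⟦γ₂⟧ T₂ ∧ IsDeckInvTransportAt (f := f) s₂.1 T₂ := by
  subst h
  have hγe : γ₁ = γ₂ := Path.ext (funext fun u => Subtype.ext (hγ u))
  subst hγe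
  exact ⟨T₁, hT₁, hP⟩

variable (hp : 2 ≤ p) (hf : f.IsHomogeneous p) (hf0 : f ≠ 0)
  (hJ : SmoothHypersurface.IsNonsingularForm ℂ (cyclicCoverForm p f))

/-- The scaling loop as one path. [cite: CarlsonToledo1999, §2 (held text p0004)] -/
def scalingLoop : Path (⟨basePt hp hf hJ, Set.mem_univ _⟩ : (Set.univ : Set (ComplexPoints (scalingBase p f))))
    ⟨basePt hp hf hJ, Set.mem_univ _⟩ :=
  (loopHalf₁ hp hf hf0 hJ).trans (loopHalf₂ hp hf hf0 hJ)

omit [NeZero p] in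
/-- Its class is `scalingLoopClass`. [cite: VoisinHodgeII2003, §3.1.2] -/
theorem mk_scalingLoop : (⟦scalingLoop hp hf hf0 hJ⟧ : Path.Homotopic.Quotient _ _) = scalingLoopClass hp hf hf0 hJ :=
  rfl

/-- **An embedding-compatible identification `𝒴_{λ=1} ≅ X_F` exists.** [cite: VoisinHodgeII2003, §6.2.1] -/
theorem exists_compatible_iso_basePt :
    ∃ e : fiberOver (scalingFamily p f) (basePt hp hf hJ) ≅ SmoothHypersurface.hypersurface (cyclicCoverForm p f),
      e.hom ≫ SmoothHypersurface.hypersurfaceι (cyclicCoverForm p f) =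
        fiberι (scalingFamily p f) (basePt hp hf hJ) ≫ totalToProjectiveSpace p f := by
  obtain ⟨e₀, he₀⟩ := exists_fiberIsoSpz_comp (Nat.pos_of_ne_zero (NeZero.ne p)) (scalingSpz p f) (basePt hp hf hJ)
  have hG : pointFormSpz ℂ 2 p (scalingSpz p f) (basePt hp hf hJ) = cyclicCoverForm p f := by
    rw [basePt, scalingPoint, pointFormSpz_pointOfFormSpz, one_smul]
  -- transport `e₀` along the equality of forms
  revert e₀ he₀
  generalize pointFormSpz ℂ 2 p (scalingSpz p f) (basePt hp hf hJ) = G at hG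
  subst hG
  intro e₀ he₀
  exact ⟨e₀, he₀⟩

/-- **The rational transport along the scaling loop is `e^* ∘ (σ_F⁻¹)^* ∘ (e^*)⁻¹`** in the scaling family.
[cite: CarlsonToledo1999, §2 (universalcyclic) (held text p0004–p0005)] [cite: VoisinHodgeII2003, §3.1.2] -/
theorem isRatTransport_scalingLoop
    (e : fiberOver (scalingFamily p f) (basePt hp hf hJ) ≅ SmoothHypersurface.hypersurface (cyclicCoverForm p f))
    (he : e.hom ≫ SmoothHypersurface.hypersurfaceι (cyclicCoverForm p f) =
      fiberι (scalingFamily p f) (basePt hp hf hJ) ≫ totalToProjectiveSpace p f) :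
    IsRatTransport (scalingFamily p f) 2 (scalingFamily_locallyTrivial p f) ⟦scalingLoop hp hf hf0 hJ⟧
      (BettiUniverse.pullEquiv e 2 ≪≫ₗ deckInvPull p f 2 ≪≫ₗ (BettiUniverse.pullEquiv e 2).symm) := by
  intro v
  have hnat : ∀ {X Y : SchemeOver ℂ} (g : X ⟶ Y) (w : bettiCohomology Y 2),
      ofRatClass _ 2 (BettiUniverse.pull g 2 w) = complexBetti.map g 2 (ofRatClass _ 2 w) := fun g w =>
    ofRatClass_map 2 (AlgPoints.mapContinuous (L := ℂ) g) w
  rw [LinearEquiv.trans_apply, LinearEquiv.trans_apply, BettiUniverse.pullEquiv_apply,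
    BettiUniverse.pullEquiv_symm_apply, deckInvPull_apply, hnat, hnat, hnat, mk_scalingLoop]
  have h0 : ofRatClass _ 2 v = complexBetti.map e.hom 2 (complexBetti.map e.inv 2 (ofRatClass _ 2 v)) :=
    (e.complexBetti_map_hom_map_inv 2 _).symm
  conv_rhs => rw [h0]
  rw [transportFun_scalingLoop hp hf hf0 hJ 2 e he]

/-- The Carlson–Toledo loop `u ↦ [x₃^p − e^{2πiu} f]` at `[x₃^p − f]` (two half-turns, endpoints cast to
`cyclicCoverPoint p f`), in the subspace `Set.univ`. [cite: CarlsonToledo1999, §2 (held text p0004)] -/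
def ctLoop : Path (⟨cyclicCoverPoint p f, Set.mem_univ _⟩ : (Set.univ : Set (ComplexPoints (cyclicCoverBase p))))
    ⟨cyclicCoverPoint p f, Set.mem_univ _⟩ :=
  ((((cyclicCoverArc hp hf hJ 0).cast (congrArg (cyclicCoverPoint p) (by rw [halfTurn_zero_zero, one_smul]))
      (congrArg (cyclicCoverPoint p) (by rw [halfTurn_zero_one]) :
        cyclicCoverPoint p (halfTurn 1 0 • f) = cyclicCoverPoint p (halfTurn 0 1 • f))).trans
    ((cyclicCoverArc hp hf hJ 1).cast rfl
      (congrArg (cyclicCoverPoint p) (by rw [halfTurn_one_one, one_smul])))).map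
      (continuous_id.subtype_mk fun x => Set.mem_univ x))

/-- The image of the scaling loop in `U(ℂ)`. [cite: VoisinHodgeII2003, §6.2.1] -/
def uLoop : Path (⟨AlgPoints.map (toBaseSpz ℂ 2 p (scalingSpz p f)) (basePt hp hf hJ), Set.mem_univ _⟩ :
      (Set.univ : Set (ComplexPoints (base ℂ 2 p))))
    ⟨AlgPoints.map (toBaseSpz ℂ 2 p (scalingSpz p f)) (basePt hp hf hJ), Set.mem_univ _⟩ :=
  (scalingLoop hp hf hf0 hJ).map (f := fun x : (Set.univ : Set (ComplexPoints (scalingBase p f))) =>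
      (⟨AlgPoints.map (toBaseSpz ℂ 2 p (scalingSpz p f)) x.1, Set.mem_univ _⟩ :
        (Set.univ : Set (ComplexPoints (base ℂ 2 p)))))
    (((AlgPoints.continuous_map _).comp continuous_subtype_val).subtype_mk _)

/-- The two base points of `U(ℂ)` agree: `[x₃^p − 1·f] = [x₃^p − f]`. [cite: CarlsonToledo1999, §2 (held text p0004)] -/
theorem map_basePt_eq :
    AlgPoints.map (toBaseSpz ℂ 2 p (scalingSpz p f)) (basePt hp hf hJ) =
      AlgPoints.map (toBaseSpz ℂ 2 p (cyclicCoverSpz p)) (cyclicCoverPoint p f) := by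
  rw [basePt, map_toBaseSpz_scalingPoint, cyclicCoverPoint_eq p hf hJ, map_toBaseSpz_pointOfFormSpz]
  apply pointForm_injective ℂ 2 p
  rw [pointForm_pointOfForm, pointForm_pointOfForm, one_smul]

/-- The Carlson–Toledo loop and the scaling loop have the same image in `U(ℂ)`, pointwise.
[cite: CarlsonToledo1999, §2 (held text p0004)] -/
theorem map_ctLoop (u : unitInterval) :
    AlgPoints.map (toBaseSpz ℂ 2 p (cyclicCoverSpz p)) (ctLoop hp hf hJ u).1 = (uLoop hp hf hf0 hJ u).1 := by
  have hL : (ctLoop hp hf hJ u).1 =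
      (((cyclicCoverArc hp hf hJ 0).cast (congrArg (cyclicCoverPoint p) (by rw [halfTurn_zero_zero, one_smul]))
        (congrArg (cyclicCoverPoint p) (by rw [halfTurn_zero_one]) :
          cyclicCoverPoint p (halfTurn 1 0 • f) = cyclicCoverPoint p (halfTurn 0 1 • f))).trans
      ((cyclicCoverArc hp hf hJ 1).cast rfl
        (congrArg (cyclicCoverPoint p) (by rw [halfTurn_one_one, one_smul])))) u := rfl
  have hR : (uLoop hp hf hf0 hJ u).1 =
      AlgPoints.map (toBaseSpz ℂ 2 p (scalingSpz p f)) (((loopHalf₁ hp hf hf0 hJ).trans (loopHalf₂ hp hf hf0 hJ)) u).1 :=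
    rfl
  rw [hL, hR, Path.trans_apply, Path.trans_apply]
  by_cases h : (u : ℝ) ≤ 1 / 2
  · rw [dif_pos h, dif_pos h]
    exact (map_toBaseSpz_cyclicCoverArc hp hf hJ 0 _).trans (map_toBaseSpz_scalingArc hp hf hf0 hJ 0 _).symm
  · rw [dif_neg h, dif_neg h]
    exact (map_toBaseSpz_cyclicCoverArc hp hf hJ 1 _).trans (map_toBaseSpz_scalingArc hp hf hf0 hJ 1 _).symm

end Deck

end CyclicCoverScaling

end Literature.AlgebraicGeometry.HodgeTheory

namespace Literature.AlgebraicGeometry.HodgeTheory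

open CategoryTheory MvPolynomial
open _root_.Topology
open Literature.AlgebraicGeometry.Motives Literature.AlgebraicGeometry.Motives.UniversalHypersurface
open Literature.AlgebraicGeometry.HodgeTheory.UniversalHypersurface
open Literature.AlgebraicTopology.SingularHomology
open Literature.NumberTheory.Transcendental
open scoped LinearAlgebra.Projectivization

namespace CyclicCoverScaling

/-! ### §6 `τ⁻¹ ∈ Γ`: the covering transformation is a monodromy transformation -/

section Final

variable {p : ℕ} [NeZero p] {f : MvPolynomial (Fin 3) ℂ}

/-- `pull` composed twice. [folklore] -/
private theorem pull_pull {X Y Z : SchemeOver ℂ} (g : X ⟶ Y) (h : Y ⟶ Z) (k : ℕ) (x : bettiCohomology Z k) :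
    BettiUniverse.pull g k (BettiUniverse.pull h k x) = BettiUniverse.pull (g ≫ h) k x := by
  rw [BettiUniverse.pull_comp]; rfl

/-- **The scaling monodromy read in the universal family satisfies `IsDeckInvTransportAt`.**
[cite: CarlsonToledo1999, §2 (universalcyclic) (held text p0004–p0005)] -/
theorem isDeckInvTransportAt_universal (hp : 2 ≤ p) (hf : f.IsHomogeneous p)
    (hJ : SmoothHypersurface.IsNonsingularForm ℂ (cyclicCoverForm p f))
    (e : fiberOver (scalingFamily p f) (basePt hp hf hJ) ≅ SmoothHypersurface.hypersurface (cyclicCoverForm p f))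
    (he : e.hom ≫ SmoothHypersurface.hypersurfaceι (cyclicCoverForm p f) =
      fiberι (scalingFamily p f) (basePt hp hf hJ) ≫ totalToProjectiveSpace p f) :
    IsDeckInvTransportAt (f := f) (AlgPoints.map (toBaseSpz ℂ 2 p (scalingSpz p f)) (basePt hp hf hJ))
      ((BettiUniverse.pullEquiv (fibIso (scalingSpz p f) (basePt hp hf hJ)) 2).symm ≪≫ₗ
        (BettiUniverse.pullEquiv e 2 ≪≫ₗ deckInvPull p f 2 ≪≫ₗ (BettiUniverse.pullEquiv e 2).symm) ≪≫ₗ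
        BettiUniverse.pullEquiv (fibIso (scalingSpz p f) (basePt hp hf hJ)) 2) := by
  set F := fibIso (scalingSpz p f) (basePt hp hf hJ) with hF
  refine ⟨F.symm ≪≫ e, ?_, fun x => ?_⟩
  · rw [Iso.trans_hom, Iso.symm_hom, Category.assoc, he, ← Category.assoc]
    have h := fiberOverFamilyPullbackIso_hom_fiberι (family ℂ 2 p) (toBaseSpz ℂ 2 p (scalingSpz p f)) (basePt hp hf hJ)
    rw [← Iso.eq_inv_comp] at h
    rw [hF, fibIso]
    erw [h]
    rfl
  · simp only [LinearEquiv.trans_apply, BettiUniverse.pullEquiv_apply, BettiUniverse.pullEquiv_symm_apply,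
      Iso.trans_hom, Iso.trans_inv, Iso.symm_hom, Iso.symm_inv, pull_pull]

/-- **The Carlson–Toledo loop carries the monodromy `e^* ∘ (σ_F⁻¹)^* ∘ (e^*)⁻¹`** for the embedding-compatible
identification `e` of the fibre with `X_F`. [cite: CarlsonToledo1999, §2 (universalcyclic) (held text p0004–p0005)]
[cite: VoisinHodgeII2003, §3.1.2] -/
theorem isRatTransport_ctLoop (hp : 2 ≤ p) (hf : f.IsHomogeneous p) (hf0 : f ≠ 0)
    (hJ : SmoothHypersurface.IsNonsingularForm ℂ (cyclicCoverForm p f))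
    (e : fiberOver (cyclicCoverFamily p) (cyclicCoverPoint p f) ≅ SmoothHypersurface.hypersurface (cyclicCoverForm p f))
    (he : IsCompatibleFibreIso p e) :
    IsRatTransport (cyclicCoverFamily p) 2 (cyclicCoverFamily_locallyTrivial p) ⟦ctLoop hp hf hJ⟧
      (BettiUniverse.pullEquiv e 2 ≪≫ₗ deckInvPull p f 2 ≪≫ₗ (BettiUniverse.pullEquiv e 2).symm) := by
  have hU : IsCohomologicallyLocallyTrivialOn (family ℂ 2 p) Set.univ :=
    isCohomologicallyLocallyTrivialOn_family 2 p NeZero.one_le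
  -- the scaling family
  obtain ⟨eL, heL⟩ := exists_compatible_iso_basePt hp hf hJ
  have hTL := isRatTransport_scalingLoop hp hf hf0 hJ eL heL
  -- to the universal family
  have hTU := (isRatTransport_familySpz_iff (scalingSpz p f) 2 hU (scalingFamily_locallyTrivial p f)
    (scalingLoop hp hf hf0 hJ) (uLoop hp hf hf0 hJ) (fun _ => rfl) _).mp hTL
  have hP := isDeckInvTransportAt_universal hp hf hJ eL heL
  -- move the base point
  have hpt : (⟨AlgPoints.map (toBaseSpz ℂ 2 p (scalingSpz p f)) (basePt hp hf hJ), Set.mem_univ _⟩ :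
      (Set.univ : Set (ComplexPoints (base ℂ 2 p)))) =
      ⟨AlgPoints.map (toBaseSpz ℂ 2 p (cyclicCoverSpz p)) (cyclicCoverPoint p f), Set.mem_univ _⟩ :=
    Subtype.ext (map_basePt_eq hp hf hJ)
  obtain ⟨T₂, hT₂, ê, hê, hT₂x⟩ := exists_isRatTransport_of_eq hU hpt (uLoop hp hf hf0 hJ)
    ((uLoop hp hf hf0 hJ).cast hpt.symm hpt.symm) (fun _ => rfl) hTU hP
  -- to the Carlson–Toledo family
  have hTCT : IsRatTransport (cyclicCoverFamily p) 2 (cyclicCoverFamily_locallyTrivial p) ⟦ctLoop hp hf hJ⟧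
      (BettiUniverse.pullEquiv (fibIso (cyclicCoverSpz p) (cyclicCoverPoint p f)) 2 ≪≫ₗ T₂ ≪≫ₗ
        (BettiUniverse.pullEquiv (fibIso (cyclicCoverSpz p) (cyclicCoverPoint p f)) 2).symm) := by
    rw [isRatTransport_familySpz_iff (cyclicCoverSpz p) 2 hU (cyclicCoverFamily_locallyTrivial p)
      (ctLoop hp hf hJ) ((uLoop hp hf hf0 hJ).cast hpt.symm hpt.symm) (map_ctLoop hp hf hf0 hJ)]
    intro v
    rw [← hT₂ v]
    congr 1
    simp only [LinearEquiv.trans_apply, LinearEquiv.apply_symm_apply]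
  -- identify the transport: `E := F ≫ ê` is compatible, hence `= e`
  have hEcompat : IsCompatibleFibreIso p (fibIso (cyclicCoverSpz p) (cyclicCoverPoint p f) ≪≫ ê) := by
    have h := fiberOverFamilyPullbackIso_hom_fiberι (family ℂ 2 p) (toBaseSpz ℂ 2 p (cyclicCoverSpz p))
      (cyclicCoverPoint p f)
    rw [isCompatibleFibreIso_iff, Iso.trans_hom, Category.assoc, hê, ← Category.assoc, fibIso]
    erw [h]
    rfl
  have hEe : fibIso (cyclicCoverSpz p) (cyclicCoverPoint p f) ≪≫ ê = e := by
    haveI := SmoothHypersurface.isClosedImmersion_hypersurfaceι_left (cyclicCoverForm p f)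
    haveI : Mono (SmoothHypersurface.hypersurfaceι (cyclicCoverForm p f)) := Over.mono_of_mono_left _
    exact Iso.ext ((cancel_mono (SmoothHypersurface.hypersurfaceι (cyclicCoverForm p f))).mp (hEcompat.trans he.symm))
  have hT₂e : BettiUniverse.pullEquiv (fibIso (cyclicCoverSpz p) (cyclicCoverPoint p f)) 2 ≪≫ₗ T₂ ≪≫ₗ
        (BettiUniverse.pullEquiv (fibIso (cyclicCoverSpz p) (cyclicCoverPoint p f)) 2).symm =
      BettiUniverse.pullEquiv e 2 ≪≫ₗ deckInvPull p f 2 ≪≫ₗ (BettiUniverse.pullEquiv e 2).symm := by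
    refine LinearEquiv.ext fun x => ?_
    rw [← hEe]
    simp only [LinearEquiv.trans_apply, BettiUniverse.pullEquiv_apply, BettiUniverse.pullEquiv_symm_apply, hT₂x,
      Iso.trans_hom, Iso.trans_inv, pull_pull]
  rw [← hT₂e]
  exact hTCT

/-- **The covering transformation is a monodromy transformation** (Carlson–Toledo family over the AFFINE space
`Ũ` of branch forms): for the embedding-compatible `e : 𝒴_{[F]} ≅ X_F` and the automorphism `τ` of `H²(𝒴_{[F]}; ℚ)`
matched with the deck transformation `σ_F^*`, both `τ⁻¹` and `τ` lie in the monodromy group `Γ` at `[F]` — `τ⁻¹`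
is the transport along the scaling loop `u ↦ [x₃^p − e^{2πiu} f]`. [cite: CarlsonToledo1999, §2 (held text p0004–p0005)]
[cite: VoisinHodgeII2003, §3.1.2] -/
theorem deck_mem_ratMonodromyGroup (hp : 2 ≤ p) (hf : f.IsHomogeneous p) (hf0 : f ≠ 0)
    (hX : IsSmoothProjective 2 (SmoothHypersurface.hypersurface (cyclicCoverForm p f)))
    (e : fiberOver (cyclicCoverFamily p) (cyclicCoverPoint p f) ≅ SmoothHypersurface.hypersurface (cyclicCoverForm p f))
    (he : IsCompatibleFibreIso p e)
    (τ : bettiCohomology (fiberOver (cyclicCoverFamily p) (cyclicCoverPoint p f)) 2 ≃ₗ[ℚ]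
      bettiCohomology (fiberOver (cyclicCoverFamily p) (cyclicCoverPoint p f)) 2)
    (hτ : ∀ (ha : deckUnit p ∈ diagonalStabilizer (cyclicCoverForm p f))
      (x : bettiCohomology (fiberOver (cyclicCoverFamily p) (cyclicCoverPoint p f)) 2),
      BettiUniverse.pullEquiv e 2 (τ x) =
        BettiUniverse.pull (diagonalAut (cyclicCoverForm p f) ha) 2 (BettiUniverse.pullEquiv e 2 x)) :
    τ⁻¹ ∈ ratMonodromyGroup (cyclicCoverFamily p) 2 (cyclicCoverFamily_locallyTrivial p)
        ⟨cyclicCoverPoint p f, Set.mem_univ _⟩ ∧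
      τ ∈ ratMonodromyGroup (cyclicCoverFamily p) 2 (cyclicCoverFamily_locallyTrivial p)
        ⟨cyclicCoverPoint p f, Set.mem_univ _⟩ := by
  have hJ := CyclicCoverFormNonsingular.isNonsingularForm_cyclicCoverForm_of_isSmoothProjective hp hf hf0 hX
  have hT := isRatTransport_ctLoop hp hf hf0 hJ e he
  have ha := deckUnit_mem_diagonalStabilizer (NeZero.ne p) f
  -- `τ ∘ T = 1`
  have hτT : τ * (BettiUniverse.pullEquiv e 2 ≪≫ₗ deckInvPull p f 2 ≪≫ₗ (BettiUniverse.pullEquiv e 2).symm) = 1 := by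
    refine LinearEquiv.ext fun x => ?_
    change τ ((BettiUniverse.pullEquiv e 2 ≪≫ₗ deckInvPull p f 2 ≪≫ₗ (BettiUniverse.pullEquiv e 2).symm) x) = x
    apply (BettiUniverse.pullEquiv e 2).injective
    rw [hτ ha, LinearEquiv.trans_apply, LinearEquiv.trans_apply, LinearEquiv.apply_symm_apply, deckInvPull_apply,
      pull_pull, diagonalAut_comp_inv_over ha, BettiUniverse.pull_id, LinearMap.id_apply]
  have hinv : τ⁻¹ = BettiUniverse.pullEquiv e 2 ≪≫ₗ deckInvPull p f 2 ≪≫ₗ (BettiUniverse.pullEquiv e 2).symm :=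
    (eq_inv_of_mul_eq_one_right hτT).symm ▸ rfl
  have hmem : τ⁻¹ ∈ ratMonodromyGroup (cyclicCoverFamily p) 2 (cyclicCoverFamily_locallyTrivial p)
      ⟨cyclicCoverPoint p f, Set.mem_univ _⟩ := by
    rw [hinv]; exact mem_ratMonodromyGroup_of_isRatTransport _ _ _ hT
  exact ⟨hmem, by simpa using Subgroup.inv_mem _ hmem⟩

end Final

end CyclicCoverScaling

section Discharge

open CyclicCoverScaling

/-- **Discharge of the named fact `carlsonToledo1999_monodromyInvariants_eq_deckInvariants`** (Carlson–Toledo 1999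
§3/§7 "the invariant cycles": monodromy invariants of `H²(𝒴_{[F]}; ℚ)` are invariant under the covering
transformation) — UNCONDITIONALLY, without Deligne's theorem of the fixed part: the covering transformation itself is
a monodromy transformation (`deck_mem_ratMonodromyGroup`). [cite: CarlsonToledo1999, §3 (held text p0006), §2 (p0005) and §7 last paragraph (p0016)] -/
theorem carlsonToledo1999_monodromyInvariants_eq_deckInvariants_holds :
    carlsonToledo1999_monodromyInvariants_eq_deckInvariants := by
  intro p _ _ h3 f hf hf0 hX e he τ hτ x hx
  have h := hx τ ((deck_mem_ratMonodromyGroup (by omega) hf hf0 hX e he τ hτ).2)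
  exact h

end Discharge

end Literature.AlgebraicGeometry.HodgeTheory

end
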